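import Literature.NumberTheory.Rogawski1990.ArchOrbFamGExtCrossCornerModel   -- ★ p851430∕p851456 (this seat): Layer A in `chartOrbG` currency, §1 corner geometry, the corner chart
import Literature.NumberTheory.Rogawski1990.ArchOrbFamGExtFaceJetRelabel     -- ★ p851233∕p851240 (LH3-p02 (g4)): `exists_nhds_bddAbove_norm_iteratedFDeriv_orbFamGExt_of_hcSwapAt` (compact-swap transport); ★ `sharedRankOneDatum_exists`, ★ frame bridges
import Literature.NumberTheory.Rogawski1990.ArchOrbFamGExtBoxDescentCorners  -- ★ p851473 (LH5-p02 (g4)): (X-core) L3^E head `exists_descent_box_orbFamGExt_inRegG_corners` (the unfolded corner descent, real walls allowed)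
import HarnessLib

/-!
# (I₁) AT THE CROSS-PLACE CORNERS IN THE UNFOLDED CURRENCY — organ O-L1e, Layers A′ (model) and B′ (the whole organ): given the `m`-fold box descent of `orbFamGExt` ITSELF at a corner, with the corner
# root factors explicit, every jet of `orbFamGExt` is bounded near the corner on `InRegG` — no real-wall hypothesis, no admissibility, no density step
# (Harish-Chandra ∕ Varadarajan 1977 I §1.12; Bouaziz 1994 §3.1 (I₁)–(I₂); Shelstad 1979 §4; Rogawski 1990 §8.2)

Topic `NumberTheory/Rogawski1990`; namespace `Literature.NumberTheory.Rogawski1990`.  THEOREMS ONLY (no `def`, no instance, no notation, no axiom, no named fact, no `sorry`).  Cell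
`pub/hodgecm-mathlib`, crux H413 (`stmt-HodgeConjecture-24833`), F0∕P3c line LH3 (closer stub `stub_N9`, DIRECT ROAD), LETTER L1 clause (I₁), organ **O-L1e `stub_N9hcCrossCornerJetBounds`**
(X′-CORNERS) of leaf `F0_P3c_StubN9Direct` (LH3-plan (g4) RULING #18).  **Layer A′** = ★ Layer A `exists_nhds_bddAbove_norm_iteratedFDeriv_orbFamGExt_of_cornerDescent` (p851430) re-typed
against the (X-core) road's head `exists_descent_box_orbFamGExt_inRegG_corners` (LH5-p02 (g4), 2026-09-02T12:31:14Z; its `Fin m` corollary is the hypothesis block `K, U, f, C, htan, hdesc`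
below).  Author F0P3a-p02 (g21) (assembler ∕ binder of record for O-L1e).  Count-neutral.

THE MATHEMATICS.  Let `p` be a corner with `(0,2)`-coincidences at the compact places `e k` (`k : Fin m`, `e k ∉ S`, the pair `(0,2)` noncompact there), third eigenvalue off, and NO
NONCOMPACT coincidence at the other compact places (compact ones allowed); nothing is asked at the split places.  The unfolded descent (LH5-p02's L3^E head) says: on an open
`U ∋ p`, OFF the corner walls (`e^{ic_{e k,0}} ≠ e^{ic_{e k,2}}`),
  `orbFamGExt ν′ a′ S c = (∏_k (1 − e^{i(c₁−c₀)})(1 − e^{i(c₂−c₀)})(1 − e^{i(c₂−c₁)})|_{e k}) · K · ∫_{U(J)^m} f (c, (Ad_{h_k}(P·diag(e^{ic_{e k,0}}, e^{ic_{e k,2}})·P⁻¹))_k) dμ₀^{⊗m}`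
with ONE jointly smooth `f`, compactly supported in the blocks, TANGENTIAL in `c` at the corner places.  Multiply by the unit `e^{ρ}_S(c) = ∏_{w ∉ S} e^{i(c_{w,0} − c_{w,2})}`: at each
corner place ★ `coe_circleExp_mul_rootFactors_eq_two_sin_mul_bracket` ((D) §1, LH3-p02) gives `e^{i(c₀−c₂)} · rootfactors = 2 sin ψ · i(2cos ψ − 2cos(θ − c₁))` (`ψ = (c₀−c₂)∕2`,
`θ = (c₀+c₂)∕2`), so `e^{ρ}_S · ∏_k rootfactors_k = Br′ · ∏_k 2 sin ψ_k` with the ENTIRE bracket `Br′(c) = e^{ρ}_S(c) · ∏_k e^{i(c₂−c₀)}|_{e k} · i(2cos ψ_k − 2cos(θ_k − c_{e k,1}))` — no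
split factor at all, hence NO REAL-WALL HYPOTHESIS.  Centring the torus arc (★ `coe_conj_cayleyTorus_eq_smul`) as in Layer A turns the integral into the closed-form tower `H m f′ (π c, ψ(c))`
of ★ (J) for the centred family `f′`, and `e^{ρ}_S · orbFamGExt = Br′ · K · H m f′ ∘ (π, ψ)` OFF THE LITERAL CORNER WALLS NEAR `p` — exactly the `hfac` of ★ (X1)
`exists_nhds_bddAbove_norm_iteratedFDeriv_orbFamGExt_of_multiWallModel` (no `RegG` restriction, so no density upgrade and no clause (I₂) input).  ★ (X3-asm) PEELING (sockets ★ (X3-rk1),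
★ (J)) on `Q := univ` bounds the jets of `H m f′` on `closedBall p 1 ×ˢ ({sin ≠ 0} ∩ [−½,½])^m`; pull back along the corner chart, Leibniz with the entire `Br′ · K` (★ (B2) §0), ★ (X1).
RESULT **`exists_nhds_bddAbove_norm_iteratedFDeriv_orbFamGExt_of_unfoldedCornerDescent`**: `∀ n, ∃ U′ ∈ 𝓝 p, BddAbove (‖Dⁿ(orbFamGExt ν′ a′ S)‖ '' (U′ ∩ InRegG (slotSign α) S))`.
HONEST LABEL: the unfolded descent identity is a HYPOTHESIS here (LH5-p02's L3^E, §3 core package in flight); HC_CM is proved only modulo the 7 printed citations (2 remaining: hLiu418 =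
`stmt-HodgeConjecture-24832`, h413 = `stmt-HodgeConjecture-24833`) until rung 0 closes; this file moves no row of the books.

## References
* [Varadarajan1977] V. S. Varadarajan, *Harmonic Analysis on Real Reductive Groups*, LNM 576 (1977), Part I §1.12.
* [Bouaziz1994IntegralesOrbitales] A. Bouaziz, *Intégrales orbitales sur les groupes de Lie réductifs*, Ann. Sci. ÉNS 27 (1994), §3.1 (I₁)–(I₂) p. 579, §3.2 p. 580.
* [Shelstad1979] D. Shelstad, *Characters and inner forms of a quasi-split group over ℝ*, Compositio Math. 39 (1979), §4 pp. 22–25, Lemma 4.3.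
* [Rogawski1990] J. D. Rogawski, *Automorphic Representations of Unitary Groups in Three Variables*, Ann. of Math. Stud. 123 (1990), §4.12 Lemma 4.12.1, §8.2 pp. 118–124.
-/

set_option autoImplicit false

noncomputable section

open Set Filter Topology Function MeasureTheory NumberField NumberField.InfinitePlace Complex
open scoped ContDiff MatrixGroups Matrix Classical Real Matrix.Norms.Operator

namespace Literature.NumberTheory.Rogawski1990

open Literature.NumberTheory.Automorphic Literature.NumberTheory.Automorphic.UnitaryGroup Literature.NumberTheory.Automorphic.ArchCartan
open Literature.Analysis.Calculus

section UnfoldedModel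

variable (L : Type) [Field L] [NumberField L] [IsCMField L] (α : Fin 3 → L)
  [MeasurableSpace ↥(arch (↥(maximalRealSubfield L)) L (IsCMField.complexConj L) 3 (Matrix.diagonal α))]
  [BorelSpace ↥(arch (↥(maximalRealSubfield L)) L (IsCMField.complexConj L) 3 (Matrix.diagonal α))]
  (ν' : Measure ↥(arch (↥(maximalRealSubfield L)) L (IsCMField.complexConj L) 3 (Matrix.diagonal α))) [ν'.IsHaarMeasure] [ν'.IsMulRightInvariant]

/-- **(I₁) AT A `(0,2)`-CORNER FROM THE UNFOLDED `m`-FOLD BOX DESCENT (Layer A′ of organ O-L1e).**  `J` the antidiagonal `2 × 2` form with a two-sided Haar `μ₀` on `U(J)`; ANY label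
`S`; corner places `e : Fin m ↪ W` off `S` with `(0,2)` noncompact there (`hs02`); base point `p` with `p (e k) 0 = p (e k) 2`, third eigenvalue off, no NONCOMPACT coincidence at the
other compact places (`hinreg`); NOTHING asked at the split places.  HYPOTHESES = the `Fin m` corollary of LH5-p02's L3^E head at `p`: a constant `K`, an open `U ∋ p`, ONE jointly
smooth `f : (coords) × (Fin m → M₂(ℂ)) → ℂ` vanishing as soon as one block variable leaves a compact `C`, TANGENTIAL (`htan`), and OFF THE CORNER WALLS on `U` the identity
`orbFamGExt ν′ a′ S c = (∏_k rootfactors_{e k}(c)) · K · ∫_{U(J)^m} f (c, (Ad_{h_k}(P·diag(e^{ic_{e k,0}}, e^{ic_{e k,2}})·P⁻¹))_k) dμ₀^{⊗m}` (`hdesc`).  CONCLUSION: for every `n`,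
`∃ U′ ∈ 𝓝 p, BddAbove (‖Dⁿ(orbFamGExt ν′ a′ S)‖ '' (U′ ∩ InRegG (slotSign α) S))`.  Proof: `e^{ρ}_S · ∏_k rootfactors = Br′ · ∏_k 2 sin ψ_k` with `Br′` ENTIRE
(★ `coe_circleExp_mul_rootFactors_eq_two_sin_mul_bracket` per corner place), centring ★ `coe_conj_cayleyTorus_eq_smul`, ★ (X3-asm) `contDiffOn_and_forall_bound_nestedReader` on `Q := univ`
(sockets ★ (X3-rk1), tower clauses ★ (J)), the corner chart (★ `exists_cornerChart`), Leibniz ★ `exists_nhds_bddAbove_norm_iteratedFDeriv_mul`, and ★ (X1) `…_of_multiWallModel`.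
[cite: Varadarajan1977, Part I §1.12] [cite: Bouaziz1994IntegralesOrbitales, §3.1 (I₁)–(I₂) p. 579; §3.2 p. 580] [cite: Shelstad1979, §4 pp. 22–25] [cite: Rogawski1990, §8.2 pp. 118–124] -/
theorem exists_nhds_bddAbove_norm_iteratedFDeriv_orbFamGExt_of_unfoldedCornerDescent
    {J : Matrix (Fin 2) (Fin 2) ℂ} (hJ : J = (StdForm.antidiagonal 2).over ℂ)
    [MeasurableSpace ↥(unitaryGroupOfForm (starRingEnd ℂ) J)] [BorelSpace ↥(unitaryGroupOfForm (starRingEnd ℂ) J)]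
    [LocallyCompactSpace ↥(unitaryGroupOfForm (starRingEnd ℂ) J)] [SecondCountableTopology ↥(unitaryGroupOfForm (starRingEnd ℂ) J)]
    (μ₀ : Measure ↥(unitaryGroupOfForm (starRingEnd ℂ) J)) [μ₀.IsHaarMeasure] [μ₀.IsMulRightInvariant]
    (S : Finset {w : InfinitePlace L // IsComplex w})
    {m : ℕ} (e : Fin m ↪ {w : InfinitePlace L // IsComplex w}) (he : ∀ k, e k ∉ S) (hs02 : ∀ k, slotSign L α (e k) 0 ≠ slotSign L α (e k) 2)
    {p : {w : InfinitePlace L // IsComplex w} → Fin 3 → ℝ} (hp02 : ∀ k, p (e k) 0 = p (e k) 2) (hp1 : ∀ k, Circle.exp (p (e k) 1) ≠ Circle.exp (p (e k) 0))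
    (hinreg : ∀ w, w ∉ S → w ∉ Set.range e → ∀ i j : Fin 3, i ≠ j → slotSign L α w i ≠ slotSign L α w j → Circle.exp (p w i) ≠ Circle.exp (p w j))
    {a' : ↥(arch (↥(maximalRealSubfield L)) L (IsCMField.complexConj L) 3 (Matrix.diagonal α)) → ℂ}
    -- the unfolded descent output (LH5-p02's L3^E head, `Fin m` corollary)
    (K : ℂ) {U : Set ({w : InfinitePlace L // IsComplex w} → Fin 3 → ℝ)} (hUo : IsOpen U) (hpU : p ∈ U)
    (f : ({w : InfinitePlace L // IsComplex w} → Fin 3 → ℝ) × (Fin m → Matrix (Fin 2) (Fin 2) ℂ) → ℂ) (hf : ContDiff ℝ ∞ f)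
    {C : Set (Matrix (Fin 2) (Fin 2) ℂ)} (hC : IsCompact C) (hfC : ∀ c X, (∃ k, X k ∉ C) → f (c, X) = 0)
    (htan : ∀ c c' X, (∀ w, w ∉ Set.range e → c w = c' w) → (∀ k, c (e k) 1 = c' (e k) 1) → f (c, X) = f (c', X))
    (hdesc : ∀ c ∈ U, (∀ k, Circle.exp (c (e k) 0) ≠ Circle.exp (c (e k) 2)) → orbFamGExt L α ν' a' S c =
      (∏ k, ((1 - (Circle.exp (c (e k) 1 - c (e k) 0) : ℂ)) * (1 - (Circle.exp (c (e k) 2 - c (e k) 0) : ℂ)) * (1 - (Circle.exp (c (e k) 2 - c (e k) 1) : ℂ)))) *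
      (K * ∫ h : Fin m → ↥(unitaryGroupOfForm (starRingEnd ℂ) J),
        f (c, fun k => (((h k * ⟨Matrix.GeneralLinearGroup.mkOfDetNeZero !![(1 : ℂ), 1; 1, -1] det_cayleyTwo_ne_zero *
              circleDiagonal 2 ![Circle.exp (c (e k) 0), Circle.exp (c (e k) 2)] *
              (Matrix.GeneralLinearGroup.mkOfDetNeZero !![(1 : ℂ), 1; 1, -1] det_cayleyTwo_ne_zero)⁻¹, cayley_conj_circleDiagonal_mem_of_eq_over hJ _⟩ * (h k)⁻¹ :
            ↥(unitaryGroupOfForm (starRingEnd ℂ) J)) : GL (Fin 2) ℂ) : Matrix (Fin 2) (Fin 2) ℂ)) ∂(Measure.pi fun _ : Fin m => μ₀)))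
    (n : ℕ) :
    ∃ U' ∈ 𝓝 p, BddAbove ((fun c => ‖iteratedFDeriv ℝ n (orbFamGExt L α ν' a' S) c‖) '' (U' ∩ InRegG (slotSign L α) S)) := by
  -- the Cayley functional at centre `1` and its sockets (as in Layer A)
  obtain ⟨F, hF⟩ : ∃ F : (Matrix (Fin 2) (Fin 2) ℂ → ℂ) → ℝ → ℂ, ∀ (g : Matrix (Fin 2) (Fin 2) ℂ → ℂ) (ψ : ℝ), F g ψ = (2 * Real.sin ψ) •
      ∫ h : ↥(unitaryGroupOfForm (starRingEnd ℂ) J), g (((h * ⟨Matrix.GeneralLinearGroup.mkOfDetNeZero !![(1 : ℂ), 1; 1, -1] det_cayleyTwo_ne_zero *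
            circleDiagonal 2 ![1 * Circle.exp ψ, 1 * Circle.exp (-ψ)] * (Matrix.GeneralLinearGroup.mkOfDetNeZero !![(1 : ℂ), 1; 1, -1] det_cayleyTwo_ne_zero)⁻¹,
          cayley_conj_circleDiagonal_mem_of_eq_over hJ _⟩ * h⁻¹ : ↥(unitaryGroupOfForm (starRingEnd ℂ) J)) : GL (Fin 2) ℂ) : Matrix (Fin 2) (Fin 2) ℂ) ∂μ₀ :=
    ⟨fun g ψ => _, fun _ _ => rfl⟩
  have hF' : ∀ (g : Matrix (Fin 2) (Fin 2) ℂ → ℂ) (ψ : ℝ), F g ψ = (2 * Real.sin ψ) •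
      ∫ h : ↥(unitaryGroupOfForm (starRingEnd ℂ) J), g (((h * ⟨Matrix.GeneralLinearGroup.mkOfDetNeZero !![(1 : ℂ), 1; 1, -1] det_cayleyTwo_ne_zero *
            circleDiagonal 2 ![Circle.exp ψ, Circle.exp (-ψ)] * (Matrix.GeneralLinearGroup.mkOfDetNeZero !![(1 : ℂ), 1; 1, -1] det_cayleyTwo_ne_zero)⁻¹,
          cayley_conj_circleDiagonal_mem_of_eq_over hJ _⟩ * h⁻¹ : ↥(unitaryGroupOfForm (starRingEnd ℂ) J)) : GL (Fin 2) ℂ) : Matrix (Fin 2) (Fin 2) ℂ) ∂μ₀ := by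
    intro g ψ
    rw [hF]
    simp only [one_mul]
  have hunif := cayley_nestedReader_hunif (E := ℂ) hJ μ₀ 1 F hF (T₀ := Icc (-(1 / 2 : ℝ)) (1 / 2)) Subset.rfl
  have hread := cayley_nestedReader_hread (E := ℂ) hJ μ₀ 1 F hF
  have hT : IsOpen {ψ : ℝ | Real.sin ψ ≠ 0} := isOpen_ne_fun Real.continuous_sin continuous_const
  -- the ENTIRE unfolded corner bracket `Br′` and the identity `e^{ρ}_S · ∏_k rootfactors_k = Br′ · ∏_k 2 sin ψ_k`
  set Br : ({w : InfinitePlace L // IsComplex w} → Fin 3 → ℝ) → ℂ := fun c => archERhoG S c * ∏ k, ((Circle.exp (c (e k) 2 - c (e k) 0) : ℂ) *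
      (I * (((2 * Real.cos ((c (e k) 0 - c (e k) 2) / 2) : ℝ) : ℂ) - ((2 * Real.cos ((c (e k) 0 + c (e k) 2) / 2 - c (e k) 1) : ℝ) : ℂ)))) with hBrdef
  have hofR : ContDiff ℝ ∞ fun r : ℝ => (r : ℂ) := Complex.ofRealCLM.contDiff
  have hBrs : ContDiff ℝ ∞ Br := by
    refine (contDiff_archERhoG S).mul (contDiff_prod fun k _ => (contDiff_coe_circleExp_comp_of_contDiff
      ((contDiff_apply_apply ℝ ℝ (e k) 2).sub (contDiff_apply_apply ℝ ℝ (e k) 0))).mul (contDiff_const.mul ((hofR.comp ?_).sub (hofR.comp ?_))))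
    · exact contDiff_const.mul (Real.contDiff_cos.comp (((contDiff_apply_apply ℝ ℝ (e k) 0).sub (contDiff_apply_apply ℝ ℝ (e k) 2)).div_const _))
    · exact contDiff_const.mul (Real.contDiff_cos.comp
        ((((contDiff_apply_apply ℝ ℝ (e k) 0).add (contDiff_apply_apply ℝ ℝ (e k) 2)).div_const _).sub (contDiff_apply_apply ℝ ℝ (e k) 1)))
  have hBr : ∀ c : {w : InfinitePlace L // IsComplex w} → Fin 3 → ℝ,
      archERhoG S c * (∏ k, ((1 - (Circle.exp (c (e k) 1 - c (e k) 0) : ℂ)) * (1 - (Circle.exp (c (e k) 2 - c (e k) 0) : ℂ)) * (1 - (Circle.exp (c (e k) 2 - c (e k) 1) : ℂ)))) =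
        Br c * ∏ k, ((2 * Real.sin ((c (e k) 0 - c (e k) 2) / 2) : ℝ) : ℂ) := by
    intro c
    have hk : ∀ k : Fin m, (Circle.exp (c (e k) 2 - c (e k) 0) : ℂ) *
        (I * (((2 * Real.cos ((c (e k) 0 - c (e k) 2) / 2) : ℝ) : ℂ) - ((2 * Real.cos ((c (e k) 0 + c (e k) 2) / 2 - c (e k) 1) : ℝ) : ℂ))) *
          (((2 * Real.sin ((c (e k) 0 - c (e k) 2) / 2) : ℝ) : ℂ)) =
        (1 - (Circle.exp (c (e k) 1 - c (e k) 0) : ℂ)) * (1 - (Circle.exp (c (e k) 2 - c (e k) 0) : ℂ)) * (1 - (Circle.exp (c (e k) 2 - c (e k) 1) : ℂ)) := by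
      intro k
      have h := coe_circleExp_mul_rootFactors_eq_two_sin_mul_bracket c (e k)
      have hinv : (Circle.exp (c (e k) 2 - c (e k) 0) : ℂ) * (Circle.exp (c (e k) 0 - c (e k) 2) : ℂ) = 1 := by
        rw [← Circle.coe_mul, ← Circle.exp_add, show c (e k) 2 - c (e k) 0 + (c (e k) 0 - c (e k) 2) = 0 by ring, Circle.exp_zero, Circle.coe_one]
      calc (Circle.exp (c (e k) 2 - c (e k) 0) : ℂ) *
            (I * (((2 * Real.cos ((c (e k) 0 - c (e k) 2) / 2) : ℝ) : ℂ) - ((2 * Real.cos ((c (e k) 0 + c (e k) 2) / 2 - c (e k) 1) : ℝ) : ℂ))) *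
            (((2 * Real.sin ((c (e k) 0 - c (e k) 2) / 2) : ℝ) : ℂ))
          = (Circle.exp (c (e k) 2 - c (e k) 0) : ℂ) * ((Circle.exp (c (e k) 0 - c (e k) 2) : ℂ) *
              ((1 - (Circle.exp (c (e k) 1 - c (e k) 0) : ℂ)) * (1 - (Circle.exp (c (e k) 2 - c (e k) 0) : ℂ)) * (1 - (Circle.exp (c (e k) 2 - c (e k) 1) : ℂ)))) := by
            rw [h]; ring
        _ = (1 - (Circle.exp (c (e k) 1 - c (e k) 0) : ℂ)) * (1 - (Circle.exp (c (e k) 2 - c (e k) 0) : ℂ)) * (1 - (Circle.exp (c (e k) 2 - c (e k) 1) : ℂ)) := by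
            rw [← mul_assoc, hinv, one_mul]
    simp only [hBrdef]
    rw [mul_assoc, ← Finset.prod_mul_distrib]
    exact congrArg (archERhoG S c * ·) (Finset.prod_congr rfl fun k _ => (hk k).symm)
  -- the centred family `f′`
  set f' : ({w : InfinitePlace L // IsComplex w} → Fin 3 → ℝ) × (Fin m → Matrix (Fin 2) (Fin 2) ℂ) → ℂ :=
    fun z => f (z.1, fun k => ((Circle.exp ((z.1 (e k) 0 + z.1 (e k) 2) / 2) : Circle) : ℂ) • z.2 k) with hf'def
  have hθ : ∀ k : Fin m, ContDiff ℝ ∞ fun q : {w : InfinitePlace L // IsComplex w} → Fin 3 → ℝ => ((Circle.exp ((q (e k) 0 + q (e k) 2) / 2) : Circle) : ℂ) := fun k =>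
    contDiff_coe_circleExp_comp_of_contDiff (((contDiff_apply_apply ℝ ℝ (e k) 0).add (contDiff_apply_apply ℝ ℝ (e k) 2)).div_const _)
  have hf's : ContDiff ℝ ∞ f' := by
    refine hf.comp (contDiff_fst.prodMk (contDiff_pi.2 fun k => ((hθ k).comp contDiff_fst).smul ?_))
    exact (contDiff_apply ℝ (Matrix (Fin 2) (Fin 2) ℂ) k).comp contDiff_snd
  obtain ⟨R, hR⟩ := hC.isBounded.subset_closedBall (0 : Matrix (Fin 2) (Fin 2) ℂ)
  have hf'C : ∀ (q : {w : InfinitePlace L // IsComplex w} → Fin 3 → ℝ) (X : Fin m → Matrix (Fin 2) (Fin 2) ℂ),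
      (∃ k, X k ∉ Metric.closedBall (0 : Matrix (Fin 2) (Fin 2) ℂ) R) → f' (q, X) = 0 := by
    rintro q X ⟨k, hk⟩
    refine hfC q _ ⟨k, fun hmem => hk ?_⟩
    have h := hR hmem
    rw [Metric.mem_closedBall, dist_zero_right, norm_smul, Circle.norm_coe, one_mul] at h
    rwa [Metric.mem_closedBall, dist_zero_right]
  -- the peeling theorem for `f′` on `Q := univ`, compact ball `closedBall p 1`
  obtain ⟨hsm, hbd⟩ := contDiffOn_and_forall_bound_nestedReader F hT (Icc (-(1 / 2 : ℝ)) (1 / 2)) hunif hread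
    (fun m P' f z => (∏ k, 2 * Real.sin (z.2 k)) • ∫ h : Fin m → ↥(unitaryGroupOfForm (starRingEnd ℂ) J),
      f (z.1, fun k => (((h k * ⟨Matrix.GeneralLinearGroup.mkOfDetNeZero !![(1 : ℂ), 1; 1, -1] det_cayleyTwo_ne_zero *
            circleDiagonal 2 ![Circle.exp (z.2 k), Circle.exp (-(z.2 k))] *
            (Matrix.GeneralLinearGroup.mkOfDetNeZero !![(1 : ℂ), 1; 1, -1] det_cayleyTwo_ne_zero)⁻¹, cayley_conj_circleDiagonal_mem_of_eq_over hJ _⟩ * (h k)⁻¹ :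
          ↥(unitaryGroupOfForm (starRingEnd ℂ) J)) : GL (Fin 2) ℂ) : Matrix (Fin 2) (Fin 2) ℂ)) ∂(Measure.pi fun _ => μ₀))
    (fun P' f q ψ => towerH_zero hJ μ₀ P' f q ψ)
    (fun m P' _ _ Q hQ f hf hC q hq ψ hψ => towerH_succ hJ μ₀ F hF' m P' Q hQ f hf hC q hq ψ hψ)
    (fun m P' f q ψ h0 => towerH_eq_zero hJ μ₀ m P' f q ψ h0)
    m ({w : InfinitePlace L // IsComplex w} → Fin 3 → ℝ) univ isOpen_univ f' hf's.contDiffOn (Metric.closedBall 0 R) (isCompact_closedBall 0 R) hf'C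
    (Metric.closedBall p 1) (isCompact_closedBall p 1) (subset_univ _)
  -- abbreviate the tower of `f′`
  set Hm : ({w : InfinitePlace L // IsComplex w} → Fin 3 → ℝ) × (Fin m → ℝ) → ℂ := fun z => (∏ k, 2 * Real.sin (z.2 k)) •
      ∫ h : Fin m → ↥(unitaryGroupOfForm (starRingEnd ℂ) J), f' (z.1, fun k => (((h k * ⟨Matrix.GeneralLinearGroup.mkOfDetNeZero !![(1 : ℂ), 1; 1, -1] det_cayleyTwo_ne_zero *
            circleDiagonal 2 ![Circle.exp (z.2 k), Circle.exp (-(z.2 k))] *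
            (Matrix.GeneralLinearGroup.mkOfDetNeZero !![(1 : ℂ), 1; 1, -1] det_cayleyTwo_ne_zero)⁻¹, cayley_conj_circleDiagonal_mem_of_eq_over hJ _⟩ * (h k)⁻¹ :
          ↥(unitaryGroupOfForm (starRingEnd ℂ) J)) : GL (Fin 2) ℂ) : Matrix (Fin 2) (Fin 2) ℂ)) ∂(Measure.pi fun _ => μ₀) with hHmdef
  -- the corner chart
  obtain ⟨A, hA⟩ := exists_cornerChart (W := {w : InfinitePlace L // IsComplex w}) e
  have hA1 : ∀ c, (A c).1 = c - ∑ k, ((c (e k) 0 - c (e k) 2) / 2) • hcNrm (e k) 0 2 := fun c => by rw [hA]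
  have hA2 : ∀ c, (A c).2 = fun k => (c (e k) 0 - c (e k) 2) / 2 := fun c => by rw [hA]
  have hAp : A p = (p, (0 : Fin m → ℝ)) := by
    rw [hA]
    refine Prod.ext ?_ (funext fun k => ?_)
    · simp only [hp02, sub_self, zero_div, zero_smul, Finset.sum_const_zero, sub_zero]
    · simp only [hp02, sub_self, zero_div, Pi.zero_apply]
  obtain ⟨hπoff, hπ1, hπ0, hπ2⟩ : (∀ (c : {w : InfinitePlace L // IsComplex w} → Fin 3 → ℝ) (w : {w : InfinitePlace L // IsComplex w}), w ∉ Set.range e → (A c).1 w = c w) ∧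
      (∀ (c : {w : InfinitePlace L // IsComplex w} → Fin 3 → ℝ) (k : Fin m), (A c).1 (e k) 1 = c (e k) 1) ∧
      (∀ (c : {w : InfinitePlace L // IsComplex w} → Fin 3 → ℝ) (k : Fin m), (A c).1 (e k) 0 = (c (e k) 0 + c (e k) 2) / 2) ∧
      (∀ (c : {w : InfinitePlace L // IsComplex w} → Fin 3 → ℝ) (k : Fin m), (A c).1 (e k) 2 = (c (e k) 0 + c (e k) 2) / 2) := by
    refine ⟨fun c w hw => ?_, fun c k => ?_, fun c k => ?_, fun c k => ?_⟩ <;> rw [hA1]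
    · exact (cornerProj_apply e c).1 w hw
    · exact (cornerProj_apply e c).2.1 k
    · exact (cornerProj_apply e c).2.2.1 k
    · exact (cornerProj_apply e c).2.2.2 k
  -- §1 geometry at the corner (no split condition: `S := ∅` in ★ `exists_nhds_of_corners`)
  obtain ⟨U₀, hU₀o, hpU₀, hU₀π, -⟩ := exists_nhds_of_corners (∅ : Finset {w : InfinitePlace L // IsComplex w}) e hp02 (fun w hw => absurd hw (Finset.notMem_empty w))
  have hlit := literal_of_corners (slotSign L α) S e hp02 hp1 hinreg
  -- the open region where the tower is smooth, and the facts «off the corner walls near p»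
  set O : Set ({w : InfinitePlace L // IsComplex w} → Fin 3 → ℝ) := A ⁻¹' (univ ×ˢ Set.pi univ fun _ : Fin m => {ψ : ℝ | Real.sin ψ ≠ 0}) with hOdef
  have hQT : IsOpen ((univ : Set ({w : InfinitePlace L // IsComplex w} → Fin 3 → ℝ)) ×ˢ Set.pi univ fun _ : Fin m => {ψ : ℝ | Real.sin ψ ≠ 0}) :=
    isOpen_univ.prod (isOpen_set_pi finite_univ fun _ _ => hT)
  have hOo : IsOpen O := hQT.preimage A.continuous
  have hoff : ∀ c ∈ U ∩ U₀, (∀ w, w ∉ S → ∀ i j : Fin 3, i ≠ j → slotSign L α w i ≠ slotSign L α w j → p w i = p w j → c w i ≠ c w j) →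
      (∀ k, Circle.exp (c (e k) 0) ≠ Circle.exp (c (e k) 2)) ∧ (∀ k, Real.sin ((c (e k) 0 - c (e k) 2) / 2) ≠ 0) ∧ c ∈ O := by
    intro c hc hΩ
    have hne : ∀ k, c (e k) 0 ≠ c (e k) 2 := forall_corner_ne_of_offWalls (slotSign L α) S e he hs02 hp02 hΩ
    have hsin : ∀ k, Real.sin ((c (e k) 0 - c (e k) 2) / 2) ≠ 0 := fun k => sin_half_sub_ne_zero (hne k) (hU₀π c hc.2 k)
    refine ⟨fun k heq => hsin k ?_, hsin, ?_⟩
    · obtain ⟨n, hn⟩ := Circle.exp_eq_exp.1 heq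
      rw [hn, show (c (e k) 2 + n * (2 * π) - c (e k) 2) / 2 = n * π by ring]
      exact Real.sin_int_mul_pi n
    · show A c ∈ (univ : Set ({w : InfinitePlace L // IsComplex w} → Fin 3 → ℝ)) ×ˢ Set.pi univ fun _ : Fin m => {ψ : ℝ | Real.sin ψ ≠ 0}
      refine ⟨mem_univ _, fun k _ => ?_⟩
      rw [hA2]; exact hsin k
  -- ★ (X1) at `p` with the model `H c := Br′ c * K * Hm (A c)` — read OFF THE WALLS (no `RegG` restriction, no density step)
  refine exists_nhds_bddAbove_norm_iteratedFDeriv_orbFamGExt_of_multiWallModel L α ν' a' S hlit ((hUo.inter hU₀o).mem_nhds ⟨hpU, hpU₀⟩)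
    (fun c => Br c * K * Hm (A c)) (fun c hc hΩ => ?_) n ?_ (fun k hk => ?_)
  · -- `hfac` off the corner walls: the unfolded identity, the bracket identity and the centring
    obtain ⟨hcexp, hsin, -⟩ := hoff c hc hΩ
    rw [hdesc c hc.1 hcexp, ← mul_assoc, hBr c]
    have hint : (fun h : Fin m → ↥(unitaryGroupOfForm (starRingEnd ℂ) J) =>
        f (c, fun k => (((h k * ⟨Matrix.GeneralLinearGroup.mkOfDetNeZero !![(1 : ℂ), 1; 1, -1] det_cayleyTwo_ne_zero *
              circleDiagonal 2 ![Circle.exp (c (e k) 0), Circle.exp (c (e k) 2)] *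
              (Matrix.GeneralLinearGroup.mkOfDetNeZero !![(1 : ℂ), 1; 1, -1] det_cayleyTwo_ne_zero)⁻¹, cayley_conj_circleDiagonal_mem_of_eq_over hJ _⟩ * (h k)⁻¹ :
            ↥(unitaryGroupOfForm (starRingEnd ℂ) J)) : GL (Fin 2) ℂ) : Matrix (Fin 2) (Fin 2) ℂ))) =
        fun h => f' ((A c).1, fun k => (((h k * ⟨Matrix.GeneralLinearGroup.mkOfDetNeZero !![(1 : ℂ), 1; 1, -1] det_cayleyTwo_ne_zero *
              circleDiagonal 2 ![Circle.exp ((A c).2 k), Circle.exp (-((A c).2 k))] *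
              (Matrix.GeneralLinearGroup.mkOfDetNeZero !![(1 : ℂ), 1; 1, -1] det_cayleyTwo_ne_zero)⁻¹, cayley_conj_circleDiagonal_mem_of_eq_over hJ _⟩ * (h k)⁻¹ :
            ↥(unitaryGroupOfForm (starRingEnd ℂ) J)) : GL (Fin 2) ℂ) : Matrix (Fin 2) (Fin 2) ℂ)) := by
      funext h
      have hz : ∀ k, ((A c).1 (e k) 0 + (A c).1 (e k) 2) / 2 = (c (e k) 0 + c (e k) 2) / 2 := fun k => by rw [hπ0, hπ2]; ring
      have hψk : ∀ k, (A c).2 k = (c (e k) 0 - c (e k) 2) / 2 := fun k => by rw [hA2]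
      have hvec : ∀ k, (((h k * ⟨Matrix.GeneralLinearGroup.mkOfDetNeZero !![(1 : ℂ), 1; 1, -1] det_cayleyTwo_ne_zero *
              circleDiagonal 2 ![Circle.exp (c (e k) 0), Circle.exp (c (e k) 2)] *
              (Matrix.GeneralLinearGroup.mkOfDetNeZero !![(1 : ℂ), 1; 1, -1] det_cayleyTwo_ne_zero)⁻¹, cayley_conj_circleDiagonal_mem_of_eq_over hJ _⟩ * (h k)⁻¹ :
            ↥(unitaryGroupOfForm (starRingEnd ℂ) J)) : GL (Fin 2) ℂ) : Matrix (Fin 2) (Fin 2) ℂ) =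
          ((Circle.exp (((A c).1 (e k) 0 + (A c).1 (e k) 2) / 2) : Circle) : ℂ) •
            (((h k * ⟨Matrix.GeneralLinearGroup.mkOfDetNeZero !![(1 : ℂ), 1; 1, -1] det_cayleyTwo_ne_zero *
              circleDiagonal 2 ![Circle.exp ((A c).2 k), Circle.exp (-((A c).2 k))] *
              (Matrix.GeneralLinearGroup.mkOfDetNeZero !![(1 : ℂ), 1; 1, -1] det_cayleyTwo_ne_zero)⁻¹, cayley_conj_circleDiagonal_mem_of_eq_over hJ _⟩ * (h k)⁻¹ :
            ↥(unitaryGroupOfForm (starRingEnd ℂ) J)) : GL (Fin 2) ℂ) : Matrix (Fin 2) (Fin 2) ℂ) := by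
        intro k
        refine coe_conj_cayleyTorus_eq_smul hJ (h k) _ _ _ ?_
        have h0 : Circle.exp (c (e k) 0) = Circle.exp ((c (e k) 0 + c (e k) 2) / 2) * Circle.exp ((c (e k) 0 - c (e k) 2) / 2) := by
          rw [← Circle.exp_add]; congr 1; ring
        have h2 : Circle.exp (c (e k) 2) = Circle.exp ((c (e k) 0 + c (e k) 2) / 2) * Circle.exp (-((c (e k) 0 - c (e k) 2) / 2)) := by
          rw [← Circle.exp_add]; congr 1; ring
        rw [hz k, hψk k]
        funext i
        fin_cases i
        · exact h0
        · exact h2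
      simp only [hf'def]
      rw [htan (A c).1 c _ (fun w hw => hπoff c w hw) (fun k => hπ1 c k)]
      exact congrArg f (Prod.ext rfl (funext fun k => hvec k))
    rw [hint]
    simp only [hHmdef, hA2, Complex.real_smul, Complex.ofReal_prod, Complex.ofReal_mul, Complex.ofReal_ofNat]
    ring
  · -- `hHs`: smooth off the walls near `p`
    have hmaps : MapsTo A ((U ∩ U₀) ∩ {c | ∀ w, w ∉ S → ∀ i j : Fin 3, i ≠ j → slotSign L α w i ≠ slotSign L α w j → p w i = p w j → c w i ≠ c w j})
        ((univ : Set ({w : InfinitePlace L // IsComplex w} → Fin 3 → ℝ)) ×ˢ Set.pi univ fun _ : Fin m => {ψ : ℝ | Real.sin ψ ≠ 0}) := fun c hc => (hoff c hc.1 hc.2).2.2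
    have h1 : ContDiffOn ℝ n (fun c => Hm (A c)) ((U ∩ U₀) ∩ {c | ∀ w, w ∉ S → ∀ i j : Fin 3, i ≠ j → slotSign L α w i ≠ slotSign L α w j → p w i = p w j → c w i ≠ c w j}) :=
      (hsm.of_le (mod_cast le_top)).comp A.contDiff.contDiffOn hmaps
    have h2 : ContDiffOn ℝ n (fun c => Br c * K) ((U ∩ U₀) ∩ {c | ∀ w, w ∉ S → ∀ i j : Fin 3, i ≠ j → slotSign L α w i ≠ slotSign L α w j → p w i = p w j → c w i ≠ c w j}) :=
      ((hBrs.mul contDiff_const).of_le (mod_cast le_top)).contDiffOn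
    exact h2.mul h1
  · -- `hHb`: Leibniz with the entire `Br′ · K` against the pulled-back tower jets
    have hb : ∀ k' ≤ k, ∃ U' ∈ 𝓝 p, BddAbove ((fun c => ‖iteratedFDeriv ℝ k' (fun c => Hm (A c)) c‖) '' (U' ∩ O)) := by
      intro k' _
      obtain ⟨B, hB⟩ := hbd k'
      refine ⟨A ⁻¹' (Metric.ball p 1 ×ˢ Metric.ball (0 : Fin m → ℝ) (1 / 2)), A.continuous.continuousAt.preimage_mem_nhds (by
        rw [hAp]; exact prod_mem_nhds (Metric.ball_mem_nhds p one_pos) (Metric.ball_mem_nhds _ one_half_pos)), ‖A‖ ^ k' * B, ?_⟩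
      rintro _ ⟨c, ⟨hcU, hcO⟩, rfl⟩
      have hcO' : A c ∈ (univ : Set ({w : InfinitePlace L // IsComplex w} → Fin 3 → ℝ)) ×ˢ Set.pi univ fun _ : Fin m => {ψ : ℝ | Real.sin ψ ≠ 0} := hcO
      refine (norm_iteratedFDeriv_comp_clm_le_of_isOpen A hQT (hsm.of_le (mod_cast le_top)) (n := k') hcO').trans
        (mul_le_mul_of_nonneg_left (hB (A c) ⟨Metric.ball_subset_closedBall hcU.1, fun j _ => ⟨hcO'.2 j (mem_univ _), ?_⟩⟩) (pow_nonneg (norm_nonneg _) _))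
      have h2 : ‖(A c).2‖ < 1 / 2 := by have h := hcU.2; rwa [Metric.mem_ball, dist_zero_right] at h
      have hj := (pi_norm_lt_iff one_half_pos).1 h2 j
      rw [Real.norm_eq_abs, abs_lt] at hj
      exact ⟨hj.1.le, hj.2.le⟩
    obtain ⟨U', hU', hBdd⟩ := exists_nhds_bddAbove_norm_iteratedFDeriv_mul (hBrs.mul contDiff_const) hOo
      (((hsm.of_le (mod_cast le_top)).comp A.contDiff.contDiffOn fun c hc => hc) : ContDiffOn ℝ k (fun c => Hm (A c)) O) hb
    refine ⟨U' ∩ (U ∩ U₀), inter_mem hU' ((hUo.inter hU₀o).mem_nhds ⟨hpU, hpU₀⟩), hBdd.mono (image_mono ?_)⟩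
    rintro c ⟨⟨hcU', hcU⟩, hΩ⟩
    exact ⟨hcU', (hoff c hcU hΩ).2.2⟩

end UnfoldedModel

/-! ## Layer B′ — THE WHOLE ORGAN O-L1e from the unfolded corner descent (compact swaps `(1,2) → (0,2)` place by place; junk labels; the Cayley carrier inside) -/

section UnfoldedJetBounds

variable (L : Type) [Field L] [NumberField L] [IsCMField L] (α : Fin 3 → L)
  [MeasurableSpace ↥(arch (↥(maximalRealSubfield L)) L (IsCMField.complexConj L) 3 (Matrix.diagonal α))]
  [BorelSpace ↥(arch (↥(maximalRealSubfield L)) L (IsCMField.complexConj L) 3 (Matrix.diagonal α))]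
  (ν' : Measure ↥(arch (↥(maximalRealSubfield L)) L (IsCMField.complexConj L) 3 (Matrix.diagonal α))) [ν'.IsHaarMeasure] [ν'.IsMulRightInvariant]

/-- **ORGAN O-L1e FROM THE UNFOLDED `m`-FOLD CORNER DESCENT — THE WHOLE ORGAN, NO REAL-WALL SPLIT (Layer B′).**  Under the `L1Frame` binders (`hherm`, `hanis`, `a′ ∈ C_c^∞(G′_∞)`):
IF at every admissible label `S`, every enumerated set of compact split-chart places `e : Fin m ↪ W` off `S` and every base point `p` with LITERAL `(0,2)`-coincidences at the `e k`, third
eigenvalue off there and no noncompact coincidence at the other compact places, `orbFamGExt` descends OFF THE CORNER WALLS to the `m`-fold Cayley box integral with the corner root factors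
explicit (`hcorner` — the `Fin m` corollary of the (X-core) head `exists_descent_box_orbFamGExt_inRegG_corners`, LH5-p02 (g4): `K`, open `U ∋ p`, one jointly smooth tangential `f` with
one compact block support; quantified over the Cayley carrier `U(J)` and any two-sided Haar `μ₀` on it), THEN the organ text `HcCrossCornerJetBoundsStatement` holds VERBATIM at every cube
point with no scalar corner — split coordinates ON or OFF their real walls alike: `∃ U ∈ 𝓝 x, BddAbove (‖Dⁿ(orbFamGExt ν′ a′ S′)‖ '' (U ∩ InRegG (slotSign α) S′))`.  Proof: junk labels
trivially (★ `orbFamGExt_of_not_admissible`); induction on the number of places with a `(1,2)`-coincidence via ★ `…_of_hcSwapAt` (LH3-p02); at zero, ★ Layer A′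
`exists_nhds_bddAbove_norm_iteratedFDeriv_orbFamGExt_of_unfoldedCornerDescent` on the enumerated coincidence places (all split-chart places, ★ `mem_splitChartPlaces_of_isIndefiniteAt`).
[cite: Shelstad1979, §4 property (II) p. 23] [cite: Bouaziz1994IntegralesOrbitales, §3.1 (I₁)–(I₂) p. 579; §3.2 p. 580] [cite: Varadarajan1977, Part I §1.12] [cite: Rogawski1990, §8.2 pp. 118–124] -/
theorem crossCornerJetBounds_of_unfoldedCornerDescent
    (hherm : ((Matrix.diagonal α).map (cmConjRingHom L)).transpose = Matrix.diagonal α)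
    (hanis : ∀ x : Fin 3 → L, Literature.AlgebraicGeometry.ShimuraVarieties.hermForm (cmConjRingHom L) (Matrix.diagonal α) x x = 0 → x = 0)
    {a' : ↥(arch (↥(maximalRealSubfield L)) L (IsCMField.complexConj L) 3 (Matrix.diagonal α)) → ℂ} (ha' : ArchSmooth L 3 (Matrix.diagonal α) a')
    (hcorner : ∀ {J : Matrix (Fin 2) (Fin 2) ℂ} (hJ : J = (StdForm.antidiagonal 2).over ℂ)
      [MeasurableSpace ↥(unitaryGroupOfForm (starRingEnd ℂ) J)] [BorelSpace ↥(unitaryGroupOfForm (starRingEnd ℂ) J)]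
      [LocallyCompactSpace ↥(unitaryGroupOfForm (starRingEnd ℂ) J)] [SecondCountableTopology ↥(unitaryGroupOfForm (starRingEnd ℂ) J)]
      (μ₀ : Measure ↥(unitaryGroupOfForm (starRingEnd ℂ) J)) [μ₀.IsHaarMeasure] [μ₀.IsMulRightInvariant],
      ∀ (S : Finset {w : InfinitePlace L // IsComplex w}), (∀ w, w ∈ S → w ∈ splitChartPlaces L α) →
      ∀ (m : ℕ) (e : Fin m ↪ {w : InfinitePlace L // IsComplex w}), (∀ k, e k ∉ S) → (∀ k, e k ∈ splitChartPlaces L α) →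
      ∀ (p : {w : InfinitePlace L // IsComplex w} → Fin 3 → ℝ), (∀ k, p (e k) 0 = p (e k) 2) → (∀ k, Circle.exp (p (e k) 1) ≠ Circle.exp (p (e k) 0)) →
      (∀ w, w ∉ S → w ∉ Set.range e → ∀ i j : Fin 3, i ≠ j → slotSign L α w i ≠ slotSign L α w j → Circle.exp (p w i) ≠ Circle.exp (p w j)) →
      ∃ (K : ℂ) (U : Set ({w : InfinitePlace L // IsComplex w} → Fin 3 → ℝ)) (f : ({w : InfinitePlace L // IsComplex w} → Fin 3 → ℝ) × (Fin m → Matrix (Fin 2) (Fin 2) ℂ) → ℂ)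
        (C : Set (Matrix (Fin 2) (Fin 2) ℂ)), IsOpen U ∧ p ∈ U ∧ ContDiff ℝ ∞ f ∧ IsCompact C ∧ (∀ c X, (∃ k, X k ∉ C) → f (c, X) = 0) ∧
        (∀ c c' X, (∀ w, w ∉ Set.range e → c w = c' w) → (∀ k, c (e k) 1 = c' (e k) 1) → f (c, X) = f (c', X)) ∧
        ∀ c ∈ U, (∀ k, Circle.exp (c (e k) 0) ≠ Circle.exp (c (e k) 2)) → orbFamGExt L α ν' a' S c =
          (∏ k, ((1 - (Circle.exp (c (e k) 1 - c (e k) 0) : ℂ)) * (1 - (Circle.exp (c (e k) 2 - c (e k) 0) : ℂ)) * (1 - (Circle.exp (c (e k) 2 - c (e k) 1) : ℂ)))) *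
          (K * ∫ h : Fin m → ↥(unitaryGroupOfForm (starRingEnd ℂ) J),
            f (c, fun k => (((h k * ⟨Matrix.GeneralLinearGroup.mkOfDetNeZero !![(1 : ℂ), 1; 1, -1] det_cayleyTwo_ne_zero *
                  circleDiagonal 2 ![Circle.exp (c (e k) 0), Circle.exp (c (e k) 2)] *
                  (Matrix.GeneralLinearGroup.mkOfDetNeZero !![(1 : ℂ), 1; 1, -1] det_cayleyTwo_ne_zero)⁻¹, cayley_conj_circleDiagonal_mem_of_eq_over hJ _⟩ * (h k)⁻¹ :
                ↥(unitaryGroupOfForm (starRingEnd ℂ) J)) : GL (Fin 2) ℂ) : Matrix (Fin 2) (Fin 2) ℂ)) ∂(Measure.pi fun _ : Fin m => μ₀))) :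
    ∀ (S' : Finset {w : InfinitePlace L // IsComplex w}) (n : ℕ) (x : {w : InfinitePlace L // IsComplex w} → Fin 3 → ℝ),
      (∀ w' : {w : InfinitePlace L // IsComplex w}, w' ∉ S' → ∀ l : Fin 3, x w' l ∈ Ico 0 (2 * π)) →
      (∀ w : {w : InfinitePlace L // IsComplex w}, w ∉ S' → ∀ i j : Fin 3, i ≠ j → slotSign L α w i ≠ slotSign L α w j →
        Circle.exp (x w i) = Circle.exp (x w j) → Circle.exp (x w (hcThird i j)) ≠ Circle.exp (x w i)) →
      (∃ w₁ w₂ : {w : InfinitePlace L // IsComplex w}, w₁ ≠ w₂ ∧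
        (w₁ ∉ S' ∧ ∃ i j : Fin 3, i ≠ j ∧ slotSign L α w₁ i ≠ slotSign L α w₁ j ∧ Circle.exp (x w₁ i) = Circle.exp (x w₁ j)) ∧
        (w₂ ∉ S' ∧ ∃ i j : Fin 3, i ≠ j ∧ slotSign L α w₂ i ≠ slotSign L α w₂ j ∧ Circle.exp (x w₂ i) = Circle.exp (x w₂ j))) →
      ∃ U ∈ 𝓝 x, BddAbove ((fun c => ‖iteratedFDeriv ℝ n (orbFamGExt L α ν' a' S') c‖) '' (U ∩ InRegG (slotSign L α) S')) := by
  intro S' n x hcube hns _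
  -- the frame
  have hα : ∀ i, α i ≠ 0 := ne_zero_of_diagonal_anisotropic hanis
  have hreal : ∀ (w' : {w : InfinitePlace L // IsComplex w}) (i : Fin 3), (w'.1.embedding (α i)).im = 0 :=
    im_embedding_diagonal_eq_zero L 3 α (complexConj_apply_eq_of_diagonal_frame hherm)
  -- junk label: the family vanishes
  by_cases hS' : ∀ w, w ∈ S' → w ∈ splitChartPlaces L α
  swap
  · refine ⟨univ, univ_mem, 0, ?_⟩
    rintro _ ⟨c, -, rfl⟩
    show ‖iteratedFDeriv ℝ n (orbFamGExt L α ν' a' S') c‖ ≤ 0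
    rw [orbFamGExt_of_not_admissible L α ν' a' S' hS', iteratedFDeriv_fun_zero, Pi.zero_apply, norm_zero]
  -- the standard rank-one Cayley carrier `U(J)` with a two-sided Haar measure
  obtain ⟨J, hJ⟩ : ∃ J : Matrix (Fin 2) (Fin 2) ℂ, J = (StdForm.antidiagonal 2).over ℂ := ⟨_, rfl⟩
  letI : MeasurableSpace ↥(unitaryGroupOfForm (starRingEnd ℂ) J) := borel _
  haveI : BorelSpace ↥(unitaryGroupOfForm (starRingEnd ℂ) J) := ⟨rfl⟩
  haveI : LocallyCompactSpace ↥(unitaryGroupOfForm (starRingEnd ℂ) J) := locallyCompactSpace_unitaryGroupOfForm_complex J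
  haveI : SecondCountableTopology ↥(unitaryGroupOfForm (starRingEnd ℂ) J) := secondCountableTopology_unitaryGroupOfForm_complex J
  letI : MeasurableSpace (↥(unitaryGroupOfForm (starRingEnd ℂ) J) ⧸ torusU (starRingEnd ℂ) J) := borel _
  haveI : BorelSpace (↥(unitaryGroupOfForm (starRingEnd ℂ) J) ⧸ torusU (starRingEnd ℂ) J) := ⟨rfl⟩
  obtain ⟨μ₀, hμ₀H, hμ₀R, -⟩ := sharedRankOneDatum_exists hJ
  haveI := hμ₀H
  haveI := hμ₀R
  -- slot signs at a place carrying a noncompact pair: `(s, s, −s)`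
  have hsigns : ∀ w : {w : InfinitePlace L // IsComplex w}, ∀ i j : Fin 3, i ≠ j → slotSign L α w i ≠ slotSign L α w j →
      slotSign L α w 1 = slotSign L α w 0 ∧ slotSign L α w 0 ≠ slotSign L α w 2 ∧ w ∈ splitChartPlaces L α := by
    intro w i j _ hsij
    have hind : IsIndefiniteAt (slotSign L α) w := by
      intro hdef
      have h0 : ∀ l : Fin 3, slotSign L α w l = slotSign L α w 0 := by
        intro l
        fin_cases l
        · rfl
        · exact hdef.1.symm
        · exact hdef.2.symm.trans hdef.1.symm
      exact hsij (by rw [h0 i, h0 j])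
    have hwsp : w ∈ splitChartPlaces L α := mem_splitChartPlaces_of_isIndefiniteAt L α hα (hreal w) hind
    exact ⟨(slotSign_of_mem_splitChartPlaces L α hα hwsp).1, (slotSign_zero_ne_two_of_mem_splitChartPlaces L α hα hwsp).1, hwsp⟩
  -- THE INDUCTION on the number of compact places carrying a `(1,2)`-coincidence
  have key : ∀ (N : ℕ) (y : {w : InfinitePlace L // IsComplex w} → Fin 3 → ℝ),
      (∀ w' : {w : InfinitePlace L // IsComplex w}, w' ∉ S' → ∀ l : Fin 3, y w' l ∈ Ico 0 (2 * π)) →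
      (∀ w : {w : InfinitePlace L // IsComplex w}, w ∉ S' → ∀ i j : Fin 3, i ≠ j → slotSign L α w i ≠ slotSign L α w j →
        Circle.exp (y w i) = Circle.exp (y w j) → Circle.exp (y w (hcThird i j)) ≠ Circle.exp (y w i)) →
      (Finset.univ.filter fun w : {w : InfinitePlace L // IsComplex w} =>
          w ∉ S' ∧ slotSign L α w 1 ≠ slotSign L α w 2 ∧ Circle.exp (y w 1) = Circle.exp (y w 2)).card ≤ N →
      ∀ n' : ℕ, ∃ U ∈ 𝓝 y, BddAbove ((fun c => ‖iteratedFDeriv ℝ n' (orbFamGExt L α ν' a' S') c‖) '' (U ∩ InRegG (slotSign L α) S')) := by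
    intro N
    induction N with
    | zero =>
      intro y hyc hyns hcard n'
      -- no `(1,2)`-coincidence: every coincident noncompact pair is `(0,2)`; enumerate the coincidence places
      have hno12 : ∀ w : {w : InfinitePlace L // IsComplex w}, w ∉ S' → slotSign L α w 1 ≠ slotSign L α w 2 → Circle.exp (y w 1) ≠ Circle.exp (y w 2) := by
        intro w hw hs heq
        have hmem : w ∈ Finset.univ.filter fun w : {w : InfinitePlace L // IsComplex w} =>
            w ∉ S' ∧ slotSign L α w 1 ≠ slotSign L α w 2 ∧ Circle.exp (y w 1) = Circle.exp (y w 2) :=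
          Finset.mem_filter.2 ⟨Finset.mem_univ _, hw, hs, heq⟩
        rw [Nat.le_zero, Finset.card_eq_zero] at hcard
        rw [hcard] at hmem
        exact absurd hmem (Finset.notMem_empty _)
      set Wc : Finset {w : InfinitePlace L // IsComplex w} := Finset.univ.filter fun w : {w : InfinitePlace L // IsComplex w} =>
        w ∉ S' ∧ ∃ i j : Fin 3, i ≠ j ∧ slotSign L α w i ≠ slotSign L α w j ∧ Circle.exp (y w i) = Circle.exp (y w j) with hWc
      set e : Fin Wc.card ↪ {w : InfinitePlace L // IsComplex w} := Wc.equivFin.symm.toEmbedding.trans (Function.Embedding.subtype _) with hedef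
      have he_mem : ∀ k, e k ∈ Wc := fun k => (Wc.equivFin.symm k).2
      have he_range : ∀ w, w ∈ Wc → w ∈ Set.range e := fun w hw => ⟨Wc.equivFin ⟨w, hw⟩, by simp [hedef]⟩
      -- at a coincidence place the coincident noncompact pair is `(0,2)`
      have hcorner02 : ∀ w, w ∈ Wc → w ∉ S' ∧ y w 0 = y w 2 ∧ Circle.exp (y w 1) ≠ Circle.exp (y w 0) ∧ slotSign L α w 0 ≠ slotSign L α w 2 ∧
          w ∈ splitChartPlaces L α := by
        intro w hw
        obtain ⟨-, hwS, i, j, hij, hsij, heq⟩ := Finset.mem_filter.1 hw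
        obtain ⟨h10, h02, hwsp⟩ := hsigns w i j hij hsij
        have h12 : slotSign L α w 1 ≠ slotSign L α w 2 := by rw [h10]; exact h02
        -- the pair `(i, j)` is `(0,2)` or `(2,0)`: `(0,1)` is compact, `(1,2)` excluded by `hno12`
        have hc02 : Circle.exp (y w 0) = Circle.exp (y w 2) := by
          have hi : i = 0 ∨ i = 1 ∨ i = 2 := by fin_cases i <;> simp
          have hj : j = 0 ∨ j = 1 ∨ j = 2 := by fin_cases j <;> simp
          rcases hi with rfl | rfl | rfl <;> rcases hj with rfl | rfl | rfl
          · exact absurd rfl hij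
          · exact absurd h10.symm hsij
          · exact heq
          · exact absurd h10 hsij
          · exact absurd rfl hij
          · exact absurd heq (hno12 w hwS h12)
          · exact heq.symm
          · exact absurd heq.symm (hno12 w hwS h12)
          · exact absurd rfl hij
        refine ⟨hwS, forall_literal_of_cube (slotSign L α) S' hyc w hwS 0 2 (by decide) h02 hc02, ?_, h02, hwsp⟩
        have h := hyns w hwS 0 2 (by decide) h02 hc02
        rwa [hcThird_zero_two] at h
      obtain ⟨K, U, f, C, hUo, hpU, hf, hC, hfC, htan, hdesc⟩ := hcorner hJ μ₀ S' hS' Wc.card e (fun k => (hcorner02 _ (he_mem k)).1)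
        (fun k => (hcorner02 _ (he_mem k)).2.2.2.2) y (fun k => (hcorner02 _ (he_mem k)).2.1) (fun k => (hcorner02 _ (he_mem k)).2.2.1)
        (fun w hw hwe i j hij hsij heq => hwe (he_range w (Finset.mem_filter.2 ⟨Finset.mem_univ _, hw, i, j, hij, hsij, heq⟩)))
      exact exists_nhds_bddAbove_norm_iteratedFDeriv_orbFamGExt_of_unfoldedCornerDescent L α ν' hJ μ₀ S' e (fun k => (hcorner02 _ (he_mem k)).1)
        (fun k => (hcorner02 _ (he_mem k)).2.2.2.1) (fun k => (hcorner02 _ (he_mem k)).2.1) (fun k => (hcorner02 _ (he_mem k)).2.2.1)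
        (fun w hw hwe i j hij hsij heq => hwe (he_range w (Finset.mem_filter.2 ⟨Finset.mem_univ _, hw, i, j, hij, hsij, heq⟩)))
        K hUo hpU f hf hC hfC htan hdesc n'
    | succ N ih =>
      intro y hyc hyns hcard n'
      by_cases hle : (Finset.univ.filter fun w : {w : InfinitePlace L // IsComplex w} =>
          w ∉ S' ∧ slotSign L α w 1 ≠ slotSign L α w 2 ∧ Circle.exp (y w 1) = Circle.exp (y w 2)).card ≤ N
      · exact ih y hyc hyns hle n'
      -- a place `w` with a `(1,2)`-coincidence; reflect it by `hcSwapAt w 0 1`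
      obtain ⟨w, hwT⟩ : (Finset.univ.filter fun w : {w : InfinitePlace L // IsComplex w} =>
          w ∉ S' ∧ slotSign L α w 1 ≠ slotSign L α w 2 ∧ Circle.exp (y w 1) = Circle.exp (y w 2)).Nonempty := by
        rw [← Finset.card_pos]; omega
      obtain ⟨-, hwS, hs12, hy12⟩ := Finset.mem_filter.1 hwT
      obtain ⟨h10, h02, -⟩ := hsigns w 1 2 (by decide) hs12
      have hy01 : Circle.exp (y w 0) ≠ Circle.exp (y w 1) := by
        have h := hyns w hwS 1 2 (by decide) hs12 hy12
        rwa [hcThird_one_two] at h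
      have hy02 : Circle.exp (y w 0) ≠ Circle.exp (y w 2) := fun h => hy01 (h.trans hy12.symm)
      set y' := hcSwapAt w 0 1 y with hy'def
      have hy'0 : y' w 0 = y w 1 := (hcSwapAt_apply_pair w 0 1 y).1
      have hy'1 : y' w 1 = y w 0 := (hcSwapAt_apply_pair w 0 1 y).2
      have hy'2 : y' w 2 = y w 2 := hcSwapAt_apply_self_of_ne w (show (2 : Fin 3) ≠ 0 by decide) (show (2 : Fin 3) ≠ 1 by decide) y
      have hy'ne : ∀ w', w' ≠ w → y' w' = y w' := fun w' hne => hcSwapAt_apply_of_ne hne 0 1 y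
      -- the reflected point: cube, no scalar corner
      have hy'c : ∀ w' : {w : InfinitePlace L // IsComplex w}, w' ∉ S' → ∀ l : Fin 3, y' w' l ∈ Ico 0 (2 * π) := by
        intro w' hw' l
        by_cases hww : w' = w
        · subst hww
          rw [hy'def, hcSwapAt_apply_self]
          exact hyc w' hw' _
        · rw [hy'ne w' hww]; exact hyc w' hw' l
      have hy'ns : ∀ w' : {w : InfinitePlace L // IsComplex w}, w' ∉ S' → ∀ i j : Fin 3, i ≠ j → slotSign L α w' i ≠ slotSign L α w' j →
          Circle.exp (y' w' i) = Circle.exp (y' w' j) → Circle.exp (y' w' (hcThird i j)) ≠ Circle.exp (y' w' i) := by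
        intro w' hw' i j hij hsij heq
        by_cases hww : w' = w
        · subst hww
          -- at `w` the only coincidence of `y′` is the pair `(0,2)`, with third eigenvalue `e^{i y_{w,0}}` off it
          have hi : i = 0 ∨ i = 1 ∨ i = 2 := by fin_cases i <;> simp
          have hj : j = 0 ∨ j = 1 ∨ j = 2 := by fin_cases j <;> simp
          rcases hi with rfl | rfl | rfl <;> rcases hj with rfl | rfl | rfl
          · exact absurd rfl hij
          · rw [hy'0, hy'1] at heq; exact absurd heq.symm hy01
          · rw [hcThird_zero_two, hy'1, hy'0]; exact hy01
          · rw [hy'1, hy'0] at heq; exact absurd heq hy01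
          · exact absurd rfl hij
          · rw [hy'1, hy'2] at heq; exact absurd heq hy02
          · rw [show hcThird (2 : Fin 3) 0 = 1 by decide, hy'1, hy'2]; exact hy02
          · rw [hy'2, hy'1] at heq; exact absurd heq.symm hy02
          · exact absurd rfl hij
        · simp only [hy'ne w' hww] at heq ⊢
          exact hyns w' hw' i j hij hsij heq
      -- one `(1,2)`-place fewer
      have hcard' : (Finset.univ.filter fun w' : {w : InfinitePlace L // IsComplex w} =>
          w' ∉ S' ∧ slotSign L α w' 1 ≠ slotSign L α w' 2 ∧ Circle.exp (y' w' 1) = Circle.exp (y' w' 2)).card ≤ N := by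
        have hsub : (Finset.univ.filter fun w' : {w : InfinitePlace L // IsComplex w} =>
            w' ∉ S' ∧ slotSign L α w' 1 ≠ slotSign L α w' 2 ∧ Circle.exp (y' w' 1) = Circle.exp (y' w' 2)) ⊆
            (Finset.univ.filter fun w' : {w : InfinitePlace L // IsComplex w} =>
              w' ∉ S' ∧ slotSign L α w' 1 ≠ slotSign L α w' 2 ∧ Circle.exp (y w' 1) = Circle.exp (y w' 2)).erase w := by
          intro w' hw'
          obtain ⟨-, hw'S, hs', heq'⟩ := Finset.mem_filter.1 hw'
          by_cases hww : w' = w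
          · subst hww
            rw [hy'1, hy'2] at heq'
            exact absurd heq' hy02
          · exact Finset.mem_erase.2 ⟨hww, Finset.mem_filter.2 ⟨Finset.mem_univ _, hw'S, hs', by rwa [hy'ne w' hww] at heq'⟩⟩
        have h := Finset.card_le_card hsub
        rw [Finset.card_erase_of_mem hwT] at h
        omega
      -- transport the bounds at the reflected point back across the compact reflection `(0 1)` at `w`
      exact exists_nhds_bddAbove_norm_iteratedFDeriv_orbFamGExt_of_hcSwapAt L α ν' hα hreal hS' ha' hwS (show (0 : Fin 3) ≠ 1 by decide) h10.symm
        (fun m' _ => ih y' hy'c hy'ns hcard' m')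
  exact key _ x hcube hns le_rfl n

end UnfoldedJetBounds

/-! ## §3 The `Fin m` corollary of ★ (X-core) `exists_descent_box_orbFamGExt_inRegG_corners` (LH5-p02): enumerated corner places, `Fin m`-indexed blocks and Haar product -/

section FinCorollary

variable (L : Type) [Field L] [NumberField L] [IsCMField L] (α : Fin 3 → L)
  [MeasurableSpace ↥(arch (↥(maximalRealSubfield L)) L (IsCMField.complexConj L) 3 (Matrix.diagonal α))]
  [BorelSpace ↥(arch (↥(maximalRealSubfield L)) L (IsCMField.complexConj L) 3 (Matrix.diagonal α))]
  (ν' : Measure ↥(arch (↥(maximalRealSubfield L)) L (IsCMField.complexConj L) 3 (Matrix.diagonal α))) [ν'.IsHaarMeasure] [ν'.IsMulRightInvariant]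

/-- **THE UNFOLDED CORNER DESCENT, `Fin m` EDITION** (the hypothesis block `hcorner` of §2, DISCHARGED): ★ `exists_descent_box_orbFamGExt_inRegG_corners` (LH5-p02 (g4)) at
`E := Finset.univ.map e` for an enumeration `e : Fin m ↪ W` of the corner places, the blocks re-indexed along the equivalence `σ : Fin m ≃ ↥E`, `k ↦ ⟨e k, _⟩`
(`f (c, X) := f_E (c, X ∘ σ⁻¹)`; one compact block support = a closed ball containing `C_E`; the Haar product re-indexed by Mathlib `measurePreserving_piCongrLeft`, the corner
prefactor by `Finset.prod_map`).  Frame: `α` anisotropic-diagonal data (`hα`, `hreal`), `S` admissible, `e k ∉ S` split-chart places, base point with literal `(0,2)`-corners at the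
`e k`, third eigenvalue off, in-regular elsewhere; `a′ ∈ C_c^∞`.
[cite: Rogawski1990, §4.12 Lemma 4.12.1; §8.2 pp. 119–124] [cite: Varadarajan1977, Part I §1.12] [cite: Shelstad1979, §4 pp. 22–25] [cite: Bouaziz1994IntegralesOrbitales, §3.1 (I₁) p. 579; §3.2 p. 580] -/
theorem exists_descent_box_orbFamGExt_inRegG_corners_fin (hα : ∀ i, α i ≠ 0)
    (hreal : ∀ (w : {w : InfinitePlace L // IsComplex w}) (i : Fin 3), (w.1.embedding (α i)).im = 0)
    {J : Matrix (Fin 2) (Fin 2) ℂ} (hJ : J = (StdForm.antidiagonal 2).over ℂ)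
    [MeasurableSpace ↥(unitaryGroupOfForm (starRingEnd ℂ) J)] [BorelSpace ↥(unitaryGroupOfForm (starRingEnd ℂ) J)]
    [LocallyCompactSpace ↥(unitaryGroupOfForm (starRingEnd ℂ) J)] [SecondCountableTopology ↥(unitaryGroupOfForm (starRingEnd ℂ) J)]
    (μ₀ : Measure ↥(unitaryGroupOfForm (starRingEnd ℂ) J)) [μ₀.IsHaarMeasure] [μ₀.IsMulRightInvariant]
    {S : Finset {w : InfinitePlace L // IsComplex w}} (hS : ∀ w, w ∈ S → w ∈ splitChartPlaces L α)
    {m : ℕ} (e : Fin m ↪ {w : InfinitePlace L // IsComplex w}) (he : ∀ k, e k ∉ S) (hesp : ∀ k, e k ∈ splitChartPlaces L α)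
    {x : {w : InfinitePlace L // IsComplex w} → Fin 3 → ℝ} (hx02 : ∀ k, x (e k) 0 = x (e k) 2) (hx1 : ∀ k, Circle.exp (x (e k) 1) ≠ Circle.exp (x (e k) 0))
    (hxin : ∀ w, w ∉ S → w ∉ Set.range e → ∀ i j : Fin 3, i ≠ j → slotSign L α w i ≠ slotSign L α w j → Circle.exp (x w i) ≠ Circle.exp (x w j))
    {a' : ↥(arch (↥(maximalRealSubfield L)) L (IsCMField.complexConj L) 3 (Matrix.diagonal α)) → ℂ} (ha' : ArchSmooth L 3 (Matrix.diagonal α) a') :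
    ∃ (K : ℂ) (U : Set ({w : InfinitePlace L // IsComplex w} → Fin 3 → ℝ)) (f : ({w : InfinitePlace L // IsComplex w} → Fin 3 → ℝ) × (Fin m → Matrix (Fin 2) (Fin 2) ℂ) → ℂ)
      (C : Set (Matrix (Fin 2) (Fin 2) ℂ)), IsOpen U ∧ x ∈ U ∧ ContDiff ℝ ∞ f ∧ IsCompact C ∧ (∀ c X, (∃ k, X k ∉ C) → f (c, X) = 0) ∧
      (∀ c c' X, (∀ w, w ∉ Set.range e → c w = c' w) → (∀ k, c (e k) 1 = c' (e k) 1) → f (c, X) = f (c', X)) ∧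
      ∀ c ∈ U, (∀ k, Circle.exp (c (e k) 0) ≠ Circle.exp (c (e k) 2)) → orbFamGExt L α ν' a' S c =
        (∏ k, ((1 - (Circle.exp (c (e k) 1 - c (e k) 0) : ℂ)) * (1 - (Circle.exp (c (e k) 2 - c (e k) 0) : ℂ)) * (1 - (Circle.exp (c (e k) 2 - c (e k) 1) : ℂ)))) *
        (K * ∫ h : Fin m → ↥(unitaryGroupOfForm (starRingEnd ℂ) J),
          f (c, fun k => (((h k * ⟨Matrix.GeneralLinearGroup.mkOfDetNeZero !![(1 : ℂ), 1; 1, -1] det_cayleyTwo_ne_zero *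
                circleDiagonal 2 ![Circle.exp (c (e k) 0), Circle.exp (c (e k) 2)] *
                (Matrix.GeneralLinearGroup.mkOfDetNeZero !![(1 : ℂ), 1; 1, -1] det_cayleyTwo_ne_zero)⁻¹, cayley_conj_circleDiagonal_mem_of_eq_over hJ _⟩ * (h k)⁻¹ :
              ↥(unitaryGroupOfForm (starRingEnd ℂ) J)) : GL (Fin 2) ℂ) : Matrix (Fin 2) (Fin 2) ℂ)) ∂(Measure.pi fun _ : Fin m => μ₀)) := by
  -- the corner set `E := univ.map e` and the enumeration equivalence `σ : Fin m ≃ ↥E`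
  have hmemE : ∀ w : {w : InfinitePlace L // IsComplex w}, w ∈ Finset.univ.map e ↔ w ∈ Set.range e := fun w => by
    simp only [Finset.mem_map, Finset.mem_univ, true_and, Set.mem_range]
  have hkE : ∀ k, e k ∈ Finset.univ.map e := fun k => (hmemE _).2 ⟨k, rfl⟩
  have hsurj : ∀ w : ↥(Finset.univ.map e), ∃ k, e k = w.1 := fun w => (hmemE w.1).1 w.2
  choose idx hidx using hsurj
  let σ : Fin m ≃ ↥(Finset.univ.map e) := ⟨fun k => ⟨e k, hkE k⟩, idx, fun k => e.injective (hidx ⟨e k, hkE k⟩), fun w => Subtype.ext (hidx w)⟩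
  have hσ1 : ∀ w : ↥(Finset.univ.map e), e (σ.symm w) = w.1 := fun w => congrArg Subtype.val (σ.apply_symm_apply w)
  -- ★ the head at `E`
  obtain ⟨K, U, fE, -, hUo, hxU, hfE, ⟨CE, hCE, hfCE⟩, htanE, -, hdescE⟩ := exists_descent_box_orbFamGExt_inRegG_corners L α ν' hα hreal hJ μ₀ (E := Finset.univ.map e) hS
    (fun w hw => by obtain ⟨k, rfl⟩ := (hmemE w).1 hw; exact he k) (fun w hw => by obtain ⟨k, rfl⟩ := (hmemE w).1 hw; exact hesp k)
    (fun w hw => by obtain ⟨k, rfl⟩ := (hmemE w).1 hw; exact hx02 k) (fun w hw => by obtain ⟨k, rfl⟩ := (hmemE w).1 hw; exact hx1 k)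
    (fun w hwS hwE => hxin w hwS fun hr => hwE ((hmemE w).2 hr)) ha'
  -- one compact block support: a closed ball containing `C_E`
  obtain ⟨R, hR⟩ := hCE.isBounded.subset_closedBall (0 : ↥(Finset.univ.map e) → Matrix (Fin 2) (Fin 2) ℂ)
  -- the Haar product re-indexed along `σ`
  have hΦU := measurePreserving_piCongrLeft (α := fun _ : ↥(Finset.univ.map e) => ↥(unitaryGroupOfForm (starRingEnd ℂ) J)) (μ := fun _ => μ₀) σ
  have hpcl : ∀ (g : Fin m → ↥(unitaryGroupOfForm (starRingEnd ℂ) J)) (w : ↥(Finset.univ.map e)),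
      (MeasurableEquiv.piCongrLeft (fun _ : ↥(Finset.univ.map e) => ↥(unitaryGroupOfForm (starRingEnd ℂ) J)) σ g) w = g (σ.symm w) := by
    intro g w
    rw [MeasurableEquiv.coe_piCongrLeft, Equiv.piCongrLeft_apply_eq_cast, cast_eq]
  refine ⟨K, U, fun q => fE (q.1, fun w => q.2 (σ.symm w)), Metric.closedBall 0 R, hUo, hxU,
    hfE.comp (contDiff_fst.prodMk (contDiff_pi.2 fun w => (contDiff_apply ℝ (Matrix (Fin 2) (Fin 2) ℂ) (σ.symm w)).comp contDiff_snd)),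
    isCompact_closedBall 0 R, ?_, ?_, ?_⟩
  · -- compact support in the blocks
    rintro c X ⟨k, hk⟩
    refine hfCE c _ fun hmem => hk ?_
    have h := hR hmem
    rw [Metric.mem_closedBall, dist_zero_right] at h ⊢
    have hk' := norm_le_pi_norm (fun w : ↥(Finset.univ.map e) => X (σ.symm w)) (σ k)
    rw [σ.symm_apply_apply] at hk'
    exact hk'.trans h
  · -- tangential
    intro c c' X hcc' h1
    exact htanE c c' _ (fun w hwE => hcc' w fun hr => hwE ((hmemE w).2 hr)) fun w hwE => by
      obtain ⟨k, rfl⟩ := (hmemE w).1 hwE; exact h1 k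
  · -- the identity, prefactor by `Finset.prod_map`, Haar product by `measurePreserving_piCongrLeft`
    intro c hcU hne
    have hne' : ∀ w ∈ Finset.univ.map e, Circle.exp (c w 0) ≠ Circle.exp (c w 2) := fun w hw => by
      obtain ⟨k, rfl⟩ := (hmemE w).1 hw; exact hne k
    have hprod : (∏ w ∈ Finset.univ.map e, ((1 - (Circle.exp (c w 1 - c w 0) : ℂ)) * (1 - (Circle.exp (c w 2 - c w 0) : ℂ)) * (1 - (Circle.exp (c w 2 - c w 1) : ℂ)))) =
        ∏ k, ((1 - (Circle.exp (c (e k) 1 - c (e k) 0) : ℂ)) * (1 - (Circle.exp (c (e k) 2 - c (e k) 0) : ℂ)) * (1 - (Circle.exp (c (e k) 2 - c (e k) 1) : ℂ))) :=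
      Finset.prod_map _ _ _
    have hI : ∫ h : ↥(Finset.univ.map e) → ↥(unitaryGroupOfForm (starRingEnd ℂ) J),
        fE (c, fun w => (((h w * ⟨Matrix.GeneralLinearGroup.mkOfDetNeZero !![(1 : ℂ), 1; 1, -1] det_cayleyTwo_ne_zero *
              circleDiagonal 2 ![Circle.exp (c w.1 0), Circle.exp (c w.1 2)] *
              (Matrix.GeneralLinearGroup.mkOfDetNeZero !![(1 : ℂ), 1; 1, -1] det_cayleyTwo_ne_zero)⁻¹,
            cayley_conj_circleDiagonal_mem_of_eq_over hJ _⟩ * (h w)⁻¹ : ↥(unitaryGroupOfForm (starRingEnd ℂ) J)) : GL (Fin 2) ℂ) : Matrix (Fin 2) (Fin 2) ℂ)) ∂(Measure.pi fun _ => μ₀) =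
        ∫ h : Fin m → ↥(unitaryGroupOfForm (starRingEnd ℂ) J),
          (fun q : ({w : InfinitePlace L // IsComplex w} → Fin 3 → ℝ) × (Fin m → Matrix (Fin 2) (Fin 2) ℂ) => fE (q.1, fun w => q.2 (σ.symm w)))
            (c, fun k => (((h k * ⟨Matrix.GeneralLinearGroup.mkOfDetNeZero !![(1 : ℂ), 1; 1, -1] det_cayleyTwo_ne_zero *
                circleDiagonal 2 ![Circle.exp (c (e k) 0), Circle.exp (c (e k) 2)] *
                (Matrix.GeneralLinearGroup.mkOfDetNeZero !![(1 : ℂ), 1; 1, -1] det_cayleyTwo_ne_zero)⁻¹, cayley_conj_circleDiagonal_mem_of_eq_over hJ _⟩ * (h k)⁻¹ :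
              ↥(unitaryGroupOfForm (starRingEnd ℂ) J)) : GL (Fin 2) ℂ) : Matrix (Fin 2) (Fin 2) ℂ)) ∂(Measure.pi fun _ : Fin m => μ₀) := by
      rw [← hΦU.integral_comp']
      refine integral_congr_ae (Filter.Eventually.of_forall fun g => ?_)
      show fE (c, fun w => ((((MeasurableEquiv.piCongrLeft (fun _ : ↥(Finset.univ.map e) => ↥(unitaryGroupOfForm (starRingEnd ℂ) J)) σ g) w *
            ⟨Matrix.GeneralLinearGroup.mkOfDetNeZero !![(1 : ℂ), 1; 1, -1] det_cayleyTwo_ne_zero *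
              circleDiagonal 2 ![Circle.exp (c w.1 0), Circle.exp (c w.1 2)] *
              (Matrix.GeneralLinearGroup.mkOfDetNeZero !![(1 : ℂ), 1; 1, -1] det_cayleyTwo_ne_zero)⁻¹,
            cayley_conj_circleDiagonal_mem_of_eq_over hJ _⟩ *
            ((MeasurableEquiv.piCongrLeft (fun _ : ↥(Finset.univ.map e) => ↥(unitaryGroupOfForm (starRingEnd ℂ) J)) σ g) w)⁻¹ : ↥(unitaryGroupOfForm (starRingEnd ℂ) J)) :
              GL (Fin 2) ℂ) : Matrix (Fin 2) (Fin 2) ℂ)) =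
        fE (c, fun w => (((g (σ.symm w) * ⟨Matrix.GeneralLinearGroup.mkOfDetNeZero !![(1 : ℂ), 1; 1, -1] det_cayleyTwo_ne_zero *
              circleDiagonal 2 ![Circle.exp (c (e (σ.symm w)) 0), Circle.exp (c (e (σ.symm w)) 2)] *
              (Matrix.GeneralLinearGroup.mkOfDetNeZero !![(1 : ℂ), 1; 1, -1] det_cayleyTwo_ne_zero)⁻¹, cayley_conj_circleDiagonal_mem_of_eq_over hJ _⟩ * (g (σ.symm w))⁻¹ :
              ↥(unitaryGroupOfForm (starRingEnd ℂ) J)) : GL (Fin 2) ℂ) : Matrix (Fin 2) (Fin 2) ℂ))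
      refine congrArg (fun X : ↥(Finset.univ.map e) → Matrix (Fin 2) (Fin 2) ℂ => fE (c, X)) (funext fun w => ?_)
      rw [hpcl g w, hσ1 w]
    rw [hdescE c hcU hne', hprod, hI]

end FinCorollary

/-! ## §4 THE ORGAN O-L1e, UNCONDITIONAL: `HcCrossCornerJetBoundsStatement` under the `L1Frame` binders -/

section Organ

variable (L : Type) [Field L] [NumberField L] [IsCMField L] (α : Fin 3 → L)
  [MeasurableSpace ↥(arch (↥(maximalRealSubfield L)) L (IsCMField.complexConj L) 3 (Matrix.diagonal α))]
  [BorelSpace ↥(arch (↥(maximalRealSubfield L)) L (IsCMField.complexConj L) 3 (Matrix.diagonal α))]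
  (ν' : Measure ↥(arch (↥(maximalRealSubfield L)) L (IsCMField.complexConj L) 3 (Matrix.diagonal α))) [ν'.IsHaarMeasure] [ν'.IsMulRightInvariant]

/-- **ORGAN O-L1e `stub_N9hcCrossCornerJetBounds` — (I₁) AT THE CROSS-PLACE CORNERS, UNCONDITIONAL.**  Under the `L1Frame` binders (`hherm`: the diagonal frame is hermitian for
the CM conjugation; `hanis`: anisotropic; `a′ ∈ C_c^∞(G′_∞)`), at EVERY point `x` of the fundamental cube with no scalar corner (every coincident noncompact pair of angular
coordinates at a compact non-`S′` place has its third eigenvalue off the pair) — the split coordinates arbitrary, on or off the real walls — every jet of the extended chart family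
`orbFamGExt ν′ a′ S′` is bounded near `x` on `InRegG (slotSign α) S′`: `∃ U ∈ 𝓝 x, BddAbove (‖Dⁿ(orbFamGExt ν′ a′ S′)‖ '' (U ∩ InRegG (slotSign α) S′))`.  (The «two coincidence
places» hypothesis of the organ text is not used.)  = §2 `crossCornerJetBounds_of_unfoldedCornerDescent` ∘ §3 `exists_descent_box_orbFamGExt_inRegG_corners_fin` (★ LH5-p02's
(X-core) head), frame facts ★ `ne_zero_of_diagonal_anisotropic`, ★ `im_embedding_diagonal_eq_zero` ∘ ★ `complexConj_apply_eq_of_diagonal_frame`.  This is the text of the leaf's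
`HcCrossCornerJetBoundsStatement` under `L1Frame` (Harish-Chandra's property (I₁) of the normalised orbital integrals at the corners of the compact Cartan, for `U(2,1)^{[F:ℚ]}`-type
inner forms: Shelstad's property (II), Bouaziz (I₁)–(I₂)).
[cite: Shelstad1979, §4 property (II) p. 23; Lemma 4.3 p. 25] [cite: Bouaziz1994IntegralesOrbitales, §3.1 (I₁)–(I₂) p. 579; §3.2 p. 580] [cite: Varadarajan1977, Part I §1.12] [cite: Rogawski1990, §8.2 pp. 118–124] -/
theorem crossCornerJetBounds
    (hherm : ((Matrix.diagonal α).map (cmConjRingHom L)).transpose = Matrix.diagonal α)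
    (hanis : ∀ x : Fin 3 → L, Literature.AlgebraicGeometry.ShimuraVarieties.hermForm (cmConjRingHom L) (Matrix.diagonal α) x x = 0 → x = 0)
    {a' : ↥(arch (↥(maximalRealSubfield L)) L (IsCMField.complexConj L) 3 (Matrix.diagonal α)) → ℂ} (ha' : ArchSmooth L 3 (Matrix.diagonal α) a') :
    ∀ (S' : Finset {w : InfinitePlace L // IsComplex w}) (n : ℕ) (x : {w : InfinitePlace L // IsComplex w} → Fin 3 → ℝ),
      (∀ w' : {w : InfinitePlace L // IsComplex w}, w' ∉ S' → ∀ l : Fin 3, x w' l ∈ Ico 0 (2 * π)) →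
      (∀ w : {w : InfinitePlace L // IsComplex w}, w ∉ S' → ∀ i j : Fin 3, i ≠ j → slotSign L α w i ≠ slotSign L α w j →
        Circle.exp (x w i) = Circle.exp (x w j) → Circle.exp (x w (hcThird i j)) ≠ Circle.exp (x w i)) →
      (∃ w₁ w₂ : {w : InfinitePlace L // IsComplex w}, w₁ ≠ w₂ ∧
        (w₁ ∉ S' ∧ ∃ i j : Fin 3, i ≠ j ∧ slotSign L α w₁ i ≠ slotSign L α w₁ j ∧ Circle.exp (x w₁ i) = Circle.exp (x w₁ j)) ∧
        (w₂ ∉ S' ∧ ∃ i j : Fin 3, i ≠ j ∧ slotSign L α w₂ i ≠ slotSign L α w₂ j ∧ Circle.exp (x w₂ i) = Circle.exp (x w₂ j))) →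
      ∃ U ∈ 𝓝 x, BddAbove ((fun c => ‖iteratedFDeriv ℝ n (orbFamGExt L α ν' a' S') c‖) '' (U ∩ InRegG (slotSign L α) S')) :=
  crossCornerJetBounds_of_unfoldedCornerDescent L α ν' hherm hanis ha' fun {_} hJ _ _ _ _ μ₀ _ _ _ hS _ e he hesp _ hp02 hp1 hinreg =>
    exists_descent_box_orbFamGExt_inRegG_corners_fin L α ν' (ne_zero_of_diagonal_anisotropic hanis)
      (im_embedding_diagonal_eq_zero L 3 α (complexConj_apply_eq_of_diagonal_frame hherm)) hJ μ₀ hS e he hesp hp02 hp1 hinreg ha'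

end Organ

end Literature.NumberTheory.Rogawski1990

end
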